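import Summits.AtomisticToContinuum.Crystallization.Theorems.ChartedPlanarOrderSepCounting
import Summits.AtomisticToContinuum.Crystallization.Theorems.ChartedPlanarOrderProfileSlavingLJLayerBalance
import Summits.AtomisticToContinuum.Crystallization.Theorems.ChartedPlanarOrderProfileSlavingLJKernel

/-!
# D1s `StraddleSummable Λ` HOLDS; hence D1 `NashBalance Λ` and `PS_LJ ⟸ W` (decomp-a2c lens-3 g23; part 2/2)

Blocker `N = ChartedPlanarOrder.ChartedZeroExcessLayered`, PS column (critic row 435 (1)).  D1s = `…ProfileSlavingLJBalance.StraddleSummable Λ`: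
for a `δ`-separated, clean, single-site-Nash, stacked layered door set `Layered a b w` and every gap `m`, the layer-pair forces
`pairFamily a b w (k, l) = layerForce a b (w k − w l)` are summable over the straddle set `{(k, l) | k < m ≤ l}`.

PROOF (rate-free, integer exponents).  By `…CleanStackedIndependent` the periods are independent, so `(l, i, j) ↦ i a + j b + w l`
(`layerPoint`) is injective (`…NashForceBalance.layerPoint_injective`); let `ν` be the unit stacking normal and `e` an orthonormal frame with
`e 0 = ν` (part 1).  It suffices (`Summable.of_norm_bounded`, `norm_tsum_le_tsum_norm`, `Summable.prod`) that
`Φ (k, t) = ‖pairForce (w k − layerPoint t)‖` be summable over `P = {k < m} × {t | m ≤ t₁}`.  DOMINATION (part 1, `norm_pairForce_le_W3`):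
`Φ (k, t) ≤ C · F (G (k, t))` with `F ((d, j), (x, y)) = (1+d+j)⁻³ b x b y` summable and the FIBRE MAP
`G (k, t) = ((Z_m − z_k, z_t − Z_m), (x_t − x_k, y_t − y_k))`, where `(z, x, y) = gridE` (frame coordinates at scale `δ/2`, `z` along `ν`) and
`Z_m = ⌊(2/δ) h_m⌋`, `h_l = ⟪ν, w l⟫` strictly increasing, so that `z_k ≤ Z_m ≤ z_t` on `P` and `(Z_m − z_k) + (z_t − Z_m) = |z_t − z_k|`.
FIBRES of `G` are small: given `G (k, t)`, the layer index `k` determines `gridE (layerPoint t)` hence `t` (grid injectivity on the separated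
set + `layerPoint_injective`), and the admissible `k` all have the same `z_k`, i.e. heights in a window of length `< δ/2` — at most
`N₀ = (4R₀/δ + 2)³` of them by the ★ LAYER COUNT `exists_layerCount` (each such layer has an atom within `R₀ = (‖a‖+‖b‖)/2 + δ/2` of a fixed
atom, by the in-plane density `exists_layerPoint_near` of a layer — `span{a, b} = ν^⊥`, `exists_coeffs_of_inner_eq_zero` — and the ball count
of part 1).  The fibre comparison `summable_comp_of_fibre` (part 1) concludes.

Results: ★★ `straddleSummable_holds : StraddleSummable Λ` (D1s CLOSED, every `Λ`); ★★ `nashBalance_holds : NashBalance Λ` (D1 CLOSED: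
D1a `…ProfileSlavingLJLayerBalance.layerForceBalance_holds` + D1s); ★ `profileSlavingLJ_of_tubeMonotone : TubeMonotone Λ η → ProfileSlavingLJ Λ η`
(E1 `…ProfileSlavingLJKernel.slavingKernelL1_holds` + D1).  PS column after this module: `PS_LJ(Λ, η) ⟸ W = TubeMonotone Λ η` ALONE.
Mathlib only (+ the lens-3 modules imported); `[folklore]`; no instances, no notation, sorry-free.
-/

noncomputable section

open MeasureTheory Set Metric Filter Topology
open scoped RealInnerProductSpace
open Summit.AtomisticToContinuum.Crystallization.Theorems.ChartedPlanarOrderRigidityDoor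
open Summit.AtomisticToContinuum.Crystallization.Theorems.ChartedPlanarOrderDensityDichotomy
open Summit.AtomisticToContinuum.Crystallization.Theorems.ChartedPlanarOrderMesoCut
open Summit.AtomisticToContinuum.Crystallization.Theorems.ChartedPlanarOrderProfileSlavingLJ
  (pairForce layerForce IsStacked NashBalance TubeMonotone ProfileSlavingLJ)
open Summit.AtomisticToContinuum.Crystallization.Theorems.ChartedPlanarOrderDoorLayered (Layered)
open Summit.AtomisticToContinuum.Crystallization.Theorems.ChartedPlanarOrderNashForceBalance
open Summit.AtomisticToContinuum.Crystallization.Theorems.ChartedPlanarOrderSepCounting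
open Summit.AtomisticToContinuum.Crystallization.Theorems.ChartedPlanarOrderProfileSlavingLJBalance
  (StraddleSummable straddleSet pairFamily)
open Summit.AtomisticToContinuum.Crystallization.Theorems.ChartedPlanarOrderProfileSlavingLJLayerBalance
  (nashBalance_of_straddleSummable cleanStackedIndependent_holds)
open Summit.AtomisticToContinuum.Crystallization.Theorems.ChartedPlanarOrderProfileSlavingLJKernel (profileSlavingLJ_of_pieces)

namespace Summit.AtomisticToContinuum.Crystallization.Theorems.ChartedPlanarOrderStraddleSummable

/-! ## 1. The plane of a layer: `span{a, b} = ν^⊥`, in-plane density -/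

section Plane

variable {a b ν : E3}

/-- vectors in `span{a, b}` are orthogonal to the normal. -/
theorem inner_eq_zero_of_mem_span (hνa : ⟪ν, a⟫ = 0) (hνb : ⟪ν, b⟫ = 0) {v : E3}
    (hv : v ∈ Submodule.span ℝ (Set.range ![a, b])) : ⟪ν, v⟫ = 0 := by
  obtain ⟨c, hc⟩ := (Submodule.mem_span_range_iff_exists_fun ℝ).mp hv
  rw [← hc, inner_sum]
  simp [Fin.sum_univ_two, inner_smul_right, hνa, hνb]

/-- ★ for independent `a, b` orthogonal to a unit vector `ν`, every vector orthogonal to `ν` is a real combination of `a` and `b`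
(`![ν, a, b]` is independent, hence spans `E3`). -/
theorem exists_coeffs_of_inner_eq_zero (hab : LinearIndependent ℝ ![a, b]) (hν : ‖ν‖ = 1) (hνa : ⟪ν, a⟫ = 0) (hνb : ⟪ν, b⟫ = 0)
    {v : E3} (hv : ⟪ν, v⟫ = 0) : ∃ s t : ℝ, v = s • a + t • b := by
  have hνspan : ν ∉ Submodule.span ℝ (Set.range ![a, b]) := by
    intro h
    have h0 := inner_eq_zero_of_mem_span hνa hνb h
    rw [real_inner_self_eq_norm_sq, hν] at h0
    norm_num at h0
  have hind : LinearIndependent ℝ ![ν, a, b] := linearIndependent_finCons.mpr ⟨hab, hνspan⟩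
  have htop : Submodule.span ℝ (Set.range ![ν, a, b]) = ⊤ :=
    hind.span_eq_top_of_card_eq_finrank (by rw [Fintype.card_fin]; exact finrank_euclideanSpace_fin.symm)
  have hmem : v ∈ Submodule.span ℝ (Set.range ![ν, a, b]) := by rw [htop]; exact Submodule.mem_top
  obtain ⟨c, hc⟩ := (Submodule.mem_span_range_iff_exists_fun ℝ).mp hmem
  have hc' : c 0 • ν + (c 1 • a + c 2 • b) = v := by
    rw [← hc, Fin.sum_univ_three, add_assoc]
    rfl
  have hc0 : c 0 = 0 := by
    have h0 : ⟪ν, v⟫ = c 0 := by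
      rw [← hc', inner_add_right, inner_add_right, inner_smul_right, inner_smul_right, inner_smul_right, hνa, hνb,
        real_inner_self_eq_norm_sq, hν]
      ring
    rw [hv] at h0
    exact h0.symm
  exact ⟨c 1, c 2, by rw [← hc', hc0, zero_smul, zero_add]⟩

/-- ★ **in-plane density of a layer**: a point of the affine plane of layer `l` is within `(‖a‖ + ‖b‖)/2` of an atom of layer `l`
(round the coefficients). -/
theorem exists_layerPoint_near (hab : LinearIndependent ℝ ![a, b]) (hν : ‖ν‖ = 1) (hνa : ⟪ν, a⟫ = 0) (hνb : ⟪ν, b⟫ = 0)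
    (w : ℤ → E3) (l : ℤ) {x : E3} (hx : ⟪ν, x - w l⟫ = 0) :
    ∃ i j : ℤ, dist x (layerPoint a b w (l, i, j)) ≤ (‖a‖ + ‖b‖) / 2 := by
  obtain ⟨s, t, hst⟩ := exists_coeffs_of_inner_eq_zero hab hν hνa hνb hx
  refine ⟨round s, round t, ?_⟩
  have hdiff : x - layerPoint a b w (l, round s, round t) = (s - round s) • a + (t - round t) • b := by
    have hx' : x = s • a + t • b + w l := by rw [← hst]; abel
    rw [hx', sub_smul, sub_smul]
    simp only [layerPoint]
    abel
  rw [dist_eq_norm, hdiff]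
  calc ‖(s - round s) • a + (t - round t) • b‖ ≤ ‖(s - round s) • a‖ + ‖(t - round t) • b‖ := norm_add_le _ _
    _ = |s - round s| * ‖a‖ + |t - round t| * ‖b‖ := by rw [norm_smul, norm_smul, Real.norm_eq_abs, Real.norm_eq_abs]
    _ ≤ 1 / 2 * ‖a‖ + 1 / 2 * ‖b‖ :=
        add_le_add (mul_le_mul_of_nonneg_right (abs_sub_round s) (norm_nonneg _))
          (mul_le_mul_of_nonneg_right (abs_sub_round t) (norm_nonneg _))
    _ = (‖a‖ + ‖b‖) / 2 := by ring

end Plane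


/-! ## 2. The layer count -/

section LayerCount

variable {δ : ℝ} {a b ν : E3} {w : ℤ → E3}

/-- the height of a layer point is the height of its layer. -/
theorem inner_layerPoint (hνa : ⟪ν, a⟫ = 0) (hνb : ⟪ν, b⟫ = 0) (t : ℤ × ℤ × ℤ) : ⟪ν, layerPoint a b w t⟫ = ⟪ν, w t.1⟫ := by
  simp only [layerPoint, inner_add_right, inner_smul_right, hνa, hνb, mul_zero, zero_add]

/-- ★ **layer count**: at most `N₀ = (4R₀/δ + 2)³` layers, `R₀ = (‖a‖ + ‖b‖)/2 + δ/2`, have their heights in a window of length `< δ/2`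
(each such layer has an atom within `R₀` of a fixed atom — in-plane density — and the ball count applies; distinct layers give distinct atoms). -/
theorem exists_layerCount (hδ : 0 < δ) (hab : LinearIndependent ℝ ![a, b]) (hS : IsSep δ (Layered a b w))
    (hν : ‖ν‖ = 1) (hνa : ⟪ν, a⟫ = 0) (hνb : ⟪ν, b⟫ = 0) (hνw : ∀ m : ℤ, 0 < ⟪ν, w (m + 1) - w m⟫) :
    ∃ N₀ : ℝ, 0 ≤ N₀ ∧
      ∀ s : Finset ℤ, (∀ k ∈ s, ∀ k' ∈ s, |⟪ν, w k⟫ - ⟪ν, w k'⟫| < δ / 2) → (s.card : ℝ) ≤ N₀ := by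
  classical
  obtain ⟨R₀, hR₀0, hR₀⟩ : ∃ R₀ : ℝ, 0 ≤ R₀ ∧ R₀ = (‖a‖ + ‖b‖) / 2 + δ / 2 := ⟨_, by positivity, rfl⟩
  refine ⟨(4 * R₀ / δ + 2) ^ 3, by positivity, fun s hs => ?_⟩
  rcases s.eq_empty_or_nonempty with h | ⟨k₀, hk₀⟩
  · rw [h, Finset.card_empty, Nat.cast_zero]
    positivity
  -- one atom of layer `k` near `w k₀`, for every `k ∈ s`
  have hnear : ∀ k ∈ s, ∃ q : E3, q ∈ Layered a b w ∧ dist q (w k₀) ≤ R₀ ∧ ⟪ν, q⟫ = ⟪ν, w k⟫ := by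
    intro k hk
    have hx0 : ⟪ν, (w k₀ + (⟪ν, w k⟫ - ⟪ν, w k₀⟫) • ν) - w k⟫ = 0 := by
      rw [inner_sub_right, inner_add_right, inner_smul_right, real_inner_self_eq_norm_sq, hν]
      ring
    obtain ⟨i, j, hij⟩ := exists_layerPoint_near hab hν hνa hνb w k hx0
    refine ⟨layerPoint a b w (k, i, j), layerPoint_mem _, ?_, inner_layerPoint hνa hνb _⟩
    calc dist (layerPoint a b w (k, i, j)) (w k₀)
        ≤ dist (layerPoint a b w (k, i, j)) (w k₀ + (⟪ν, w k⟫ - ⟪ν, w k₀⟫) • ν) + dist (w k₀ + (⟪ν, w k⟫ - ⟪ν, w k₀⟫) • ν) (w k₀) :=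
          dist_triangle _ _ _
      _ ≤ (‖a‖ + ‖b‖) / 2 + δ / 2 := by
          apply add_le_add
          · rw [dist_comm]; exact hij
          · rw [dist_eq_norm, add_sub_cancel_left, norm_smul, hν, mul_one, Real.norm_eq_abs]
            exact (hs k hk k₀ hk₀).le
      _ = R₀ := hR₀.symm
  choose! q hq using hnear
  -- `k ↦ q k` is injective on `s` (distinct layers have distinct heights) and lands in the ball
  have hinj : Set.InjOn q (s : Set ℤ) := by
    intro k hk k' hk' h
    have h1 : ⟪ν, w k⟫ = ⟪ν, w k'⟫ := by
      rw [← (hq k (Finset.mem_coe.mp hk)).2.2, ← (hq k' (Finset.mem_coe.mp hk')).2.2, h]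
    exact (strictMono_height hνw).injective h1
  have hcard : ((s.image q).card : ℝ) = s.card := by exact_mod_cast Finset.card_image_of_injOn hinj
  rw [← hcard]
  refine card_le_of_sep hδ hS (w k₀) hR₀0 (s.image q) fun p hp => ?_
  obtain ⟨k, hk, rfl⟩ := Finset.mem_image.mp hp
  exact ⟨(hq k hk).1, (hq k hk).2.1⟩

end LayerCount


/-! ## 3. Straddle summability -/

section Main

variable {δ : ℝ} {a b : E3} {w : ℤ → E3}

/-- atoms of distinct layers are at distance `≥ δ`. -/
theorem le_norm_sub_layerPoint (hab : LinearIndependent ℝ ![a, b]) (hst : IsStacked a b w) (hS : IsSep δ (Layered a b w))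
    {k : ℤ} {t : ℤ × ℤ × ℤ} (hkt : k ≠ t.1) : δ ≤ ‖w k - layerPoint a b w t‖ := by
  have hne : w k ≠ layerPoint a b w t := by
    intro h
    have h' : layerPoint a b w (k, 0, 0) = layerPoint a b w t := by rw [layerPoint_self]; exact h
    exact hkt (congrArg Prod.fst (layerPoint_injective hab hst h'))
  rw [← dist_eq_norm]
  exact hS (w k) ⟨k, 0, 0, by simp⟩ (layerPoint a b w t) (layerPoint_mem t) hne

/-- ★★ **straddle summability** (the analytic content of D1s): for independent periods, a stacked profile and a `δ`-separated layered set,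
the layer-pair forces are summable over every straddle set `{(k, l) | k < m ≤ l}`. -/
theorem summable_pairFamily_straddle (hδ : 0 < δ) (hab : LinearIndependent ℝ ![a, b]) (hst : IsStacked a b w)
    (hS : IsSep δ (Layered a b w)) (m : ℤ) : Summable (pairFamily a b w ∘ (↑) : straddleSet m → E3) := by
  classical
  obtain ⟨ν, hν, hνa, hνb, hνw⟩ := exists_unit_normal hst
  obtain ⟨e, he⟩ := exists_onb hν
  obtain ⟨N₀, -, hcount⟩ := exists_layerCount hδ hab hS hν hνa hνb hνw
  have hmono := strictMono_height hνw
  obtain ⟨Zm, hZm⟩ : ∃ Z : ℤ, Z = ⌊2 / δ * ⟪ν, w m⟫⌋ := ⟨_, rfl⟩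
  obtain ⟨C, hC⟩ : ∃ C : ℝ, C = ((δ⁻¹) ^ 6 + 1) * (4 / δ) ^ 7 := ⟨_, rfl⟩
  have hc2 : (0 : ℝ) < 2 / δ := by positivity
  -- grid heights along the normal
  have hz_lp : ∀ t : ℤ × ℤ × ℤ, (gridE δ e (layerPoint a b w t)).1 = ⌊2 / δ * ⟪ν, w t.1⟫⌋ := fun t => by
    rw [gridE_fst, he, inner_layerPoint hνa hνb]
  have hz_w : ∀ k : ℤ, (gridE δ e (w k)).1 = ⌊2 / δ * ⟪ν, w k⟫⌋ := fun k => by rw [gridE_fst, he]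
  have hZ_lp : ∀ t : ℤ × ℤ × ℤ, m ≤ t.1 → Zm ≤ (gridE δ e (layerPoint a b w t)).1 := fun t ht => by
    rw [hz_lp, hZm]
    exact Int.floor_mono (mul_le_mul_of_nonneg_left (hmono.monotone ht) hc2.le)
  have hZ_w : ∀ k : ℤ, k < m → (gridE δ e (w k)).1 ≤ Zm := fun k hk => by
    rw [hz_w, hZm]
    exact Int.floor_mono (mul_le_mul_of_nonneg_left (hmono.monotone hk.le) hc2.le)
  -- the fibre map `G (k, t) = ((Z_m − z_k, z_t − Z_m), (x_t − x_k, y_t − y_k))`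
  obtain ⟨G, hG⟩ : ∃ G : {k : ℤ // k < m} × {t : ℤ × ℤ × ℤ // m ≤ t.1} → (ℕ × ℕ) × (ℤ × ℤ), G = fun x =>
      (((Zm - (gridE δ e (w x.1)).1).toNat, ((gridE δ e (layerPoint a b w x.2)).1 - Zm).toNat),
        ((gridE δ e (layerPoint a b w x.2)).2.1 - (gridE δ e (w x.1)).2.1,
          (gridE δ e (layerPoint a b w x.2)).2.2 - (gridE δ e (w x.1)).2.2)) := ⟨_, rfl⟩
  -- (1) domination `Φ ≤ C · F ∘ G`
  have hdom : ∀ x : {k : ℤ // k < m} × {t : ℤ × ℤ × ℤ // m ≤ t.1},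
      ‖pairForce (w x.1 - layerPoint a b w x.2)‖ ≤ C * FWeight (G x) := by
    rintro ⟨⟨k, hk⟩, ⟨t, ht⟩⟩
    have hkt : k ≠ t.1 := by omega
    have h1 := norm_pairForce_le_W3 hδ e (le_norm_sub_layerPoint hab hst hS hkt)
    rw [← hC] at h1
    have hd : 0 ≤ Zm - (gridE δ e (w k)).1 := sub_nonneg.mpr (hZ_w k hk)
    have hj : 0 ≤ (gridE δ e (layerPoint a b w t)).1 - Zm := sub_nonneg.mpr (hZ_lp t ht)
    have hdj : (((Zm - (gridE δ e (w k)).1).toNat : ℕ) : ℝ) + ((((gridE δ e (layerPoint a b w t)).1 - Zm).toNat : ℕ) : ℝ)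
        = |((((gridE δ e (layerPoint a b w t)).1 - (gridE δ e (w k)).1 : ℤ)) : ℝ)| := by
      have e1 : (((Zm - (gridE δ e (w k)).1).toNat : ℕ) : ℤ) = Zm - (gridE δ e (w k)).1 := Int.toNat_of_nonneg hd
      have e2 : ((((gridE δ e (layerPoint a b w t)).1 - Zm).toNat : ℕ) : ℤ) = (gridE δ e (layerPoint a b w t)).1 - Zm :=
        Int.toNat_of_nonneg hj
      have e3 : (0 : ℤ) ≤ (gridE δ e (layerPoint a b w t)).1 - (gridE δ e (w k)).1 := by linarith
      rw [abs_of_nonneg (by exact_mod_cast e3)]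
      have e1' : (((Zm - (gridE δ e (w k)).1).toNat : ℕ) : ℝ) = ((Zm - (gridE δ e (w k)).1 : ℤ) : ℝ) := by
        exact_mod_cast e1
      have e2' : ((((gridE δ e (layerPoint a b w t)).1 - Zm).toNat : ℕ) : ℝ)
          = (((gridE δ e (layerPoint a b w t)).1 - Zm : ℤ) : ℝ) := by
        exact_mod_cast e2
      rw [e1', e2']
      push_cast
      ring
    have hW : W3 (gridE δ e (w k)) (gridE δ e (layerPoint a b w t)) = FWeight (G (⟨k, hk⟩, ⟨t, ht⟩)) := by
      rw [hG, W3, FWeight, cWeight]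
      dsimp only
      rw [add_assoc, hdj]
    calc ‖pairForce (w k - layerPoint a b w t)‖ ≤ C * W3 (gridE δ e (w k)) (gridE δ e (layerPoint a b w t)) := h1
      _ = C * FWeight (G (⟨k, hk⟩, ⟨t, ht⟩)) := by rw [hW]
  -- (2) the fibres of `G` have at most `N₀` elements
  have hfib : ∀ (y : (ℕ × ℕ) × (ℤ × ℤ)) (s : Finset ({k : ℤ // k < m} × {t : ℤ × ℤ × ℤ // m ≤ t.1})),
      (∀ x ∈ s, G x = y) → (s.card : ℝ) ≤ N₀ := by
    intro y s hs
    -- `x ↦ k` is injective on `s`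
    have hinj : Set.InjOn (fun x : {k : ℤ // k < m} × {t : ℤ × ℤ × ℤ // m ≤ t.1} => (x.1 : ℤ)) (s : Set _) := by
      rintro ⟨⟨k, hk⟩, ⟨t, ht⟩⟩ hx ⟨⟨k', hk'⟩, ⟨t', ht'⟩⟩ hx' (hkk : k = k')
      subst hkk
      have hEq := (hs _ (Finset.mem_coe.mp hx)).trans (hs _ (Finset.mem_coe.mp hx')).symm
      simp only [hG] at hEq
      have hj := congrArg (fun y : (ℕ × ℕ) × (ℤ × ℤ) => y.1.2) hEq
      have h21 := congrArg (fun y : (ℕ × ℕ) × (ℤ × ℤ) => y.2.1) hEq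
      have h22 := congrArg (fun y : (ℕ × ℕ) × (ℤ × ℤ) => y.2.2) hEq
      dsimp only at hj h21 h22
      have hz1 := hZ_lp t ht
      have hz2 := hZ_lp t' ht'
      have hgrid : gridE δ e (layerPoint a b w t) = gridE δ e (layerPoint a b w t') :=
        Prod.ext (by omega) (Prod.ext (by omega) (by omega))
      have hlp : layerPoint a b w t = layerPoint a b w t' :=
        gridE_injOn hδ e hS (layerPoint_mem t) (layerPoint_mem t') hgrid
      have htt : t = t' := layerPoint_injective hab hst hlp
      subst htt
      rfl
    have hcard : ((s.image fun x : {k : ℤ // k < m} × {t : ℤ × ℤ × ℤ // m ≤ t.1} => (x.1 : ℤ)).card : ℝ) = s.card := by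
      exact_mod_cast Finset.card_image_of_injOn hinj
    rw [← hcard]
    refine hcount _ fun k hk k' hk' => ?_
    obtain ⟨⟨⟨k₁, hk₁⟩, t⟩, hx, rfl⟩ := Finset.mem_image.mp hk
    obtain ⟨⟨⟨k₂, hk₂⟩, t'⟩, hx', rfl⟩ := Finset.mem_image.mp hk'
    have hEq := (hs _ hx).trans (hs _ hx').symm
    simp only [hG] at hEq
    have hd := congrArg (fun y : (ℕ × ℕ) × (ℤ × ℤ) => y.1.1) hEq
    dsimp only at hd
    have hz1 := hZ_w k₁ hk₁
    have hz2 := hZ_w k₂ hk₂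
    have hzz : (gridE δ e (w k₁)).1 = (gridE δ e (w k₂)).1 := by omega
    rw [hz_w, hz_w] at hzz
    exact abs_sub_lt_of_floor_eq hδ hzz
  -- (3) summability of `Φ` over `P`
  have hΦ : Summable fun x : {k : ℤ // k < m} × {t : ℤ × ℤ × ℤ // m ≤ t.1} => ‖pairForce (w x.1 - layerPoint a b w x.2)‖ := by
    have h1 : Summable (FWeight ∘ G) :=
      summable_comp_of_fibre G (c := fun _ => N₀) FWeight_nonneg (summable_FWeight.mul_left N₀) hfib
    exact Summable.of_nonneg_of_le (fun x => norm_nonneg _) hdom (h1.mul_left C)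
  -- (4) transfer to `straddleSet m × ℤ²` along `((k, l), (i, j)) ↦ (k, (l, −i, −j))`
  have hι : Function.Injective (fun pc : straddleSet m × (ℤ × ℤ) =>
      (((⟨pc.1.1.1, pc.1.2.1⟩ : {k : ℤ // k < m}),
        (⟨(pc.1.1.2, -pc.2.1, -pc.2.2), pc.1.2.2⟩ : {t : ℤ × ℤ × ℤ // m ≤ t.1})) :
          {k : ℤ // k < m} × {t : ℤ × ℤ × ℤ // m ≤ t.1})) := by
    rintro ⟨⟨⟨k, l⟩, hkl⟩, ⟨i, j⟩⟩ ⟨⟨⟨k', l'⟩, hkl'⟩, ⟨i', j'⟩⟩ h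
    simp only [Prod.mk.injEq, Subtype.mk.injEq, neg_inj] at h
    obtain ⟨rfl, rfl, rfl, rfl⟩ := h
    rfl
  have hN : Summable fun pc : straddleSet m × (ℤ × ℤ) =>
      ‖pairForce (w pc.1.1.1 - w pc.1.1.2 + (((pc.2.1 : ℤ) : ℝ) • a + ((pc.2.2 : ℤ) : ℝ) • b))‖ := by
    refine (hΦ.comp_injective hι).congr fun pc => ?_
    obtain ⟨⟨⟨k, l⟩, hkl⟩, ⟨i, j⟩⟩ := pc
    simp only [Function.comp_apply, layerPoint, Int.cast_neg, neg_smul]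
    congr 2
    abel
  -- (5) conclusion: `‖layerForce a b (w k − w l)‖ ≤ ∑_{i,j} ‖pairForce (w k − w l + (i a + j b))‖`
  refine Summable.of_norm_bounded hN.prod fun p => ?_
  exact norm_tsum_le_tsum_norm (hN.prod_factor p)

/-- ★★ **D1s `StraddleSummable Λ` HOLDS** (every `Λ`; independence of the periods from `…CleanStackedIndependent`). -/
theorem straddleSummable_holds (Λ : ℝ) : StraddleSummable Λ :=
  fun δ hδ a b w _ _ hS hC _ hst m => summable_pairFamily_straddle hδ (cleanStackedIndependent_holds δ hδ a b w hS hC hst) hst hS m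

/-- ★★ **D1 `NashBalance Λ` HOLDS** (every `Λ`): D1a `…ProfileSlavingLJLayerBalance.layerForceBalance_holds` and D1s. -/
theorem nashBalance_holds (Λ : ℝ) : NashBalance Λ := nashBalance_of_straddleSummable (straddleSummable_holds Λ)

/-- ★ **`PS_LJ(Λ, η) ⟸ W TubeMonotone Λ η` alone** (E1 `…ProfileSlavingLJKernel.slavingKernelL1_holds`, D1 `nashBalance_holds`). -/
theorem profileSlavingLJ_of_tubeMonotone {Λ η : ℝ} (hW : TubeMonotone Λ η) : ProfileSlavingLJ Λ η :=
  profileSlavingLJ_of_pieces (nashBalance_holds Λ) hW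

end Main

end Summit.AtomisticToContinuum.Crystallization.Theorems.ChartedPlanarOrderStraddleSummable

end
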